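import Summits.HubbardSuperconductivity.HubbardSuperconductivity.Theorems.AnisotropyChordTransferFibre3DiagonalRateLemmas

/-!
# Route `AnisotropyChord` / H0 rotor rung: the SHARP periodisation rate on the diagonal — `|a_L(n,n;0) − a_∞(n,n)| ≤ n²/L²`

Assembly of `…Fibre3DiagonalRateLemmas`: p3's `diag_rotation` at `λ = 0`, the main term `main_term_eq` (`…DiagonalValues`), the
sharp row errors (rows `p`, `L + p` cost `≤ 2(B(p) + B(L − p))`, `B(m) = πn²m/(e^{πm} − 1)`), the Lambert row sum `≤ 3/50` and the
cotangent expansion `πn²/(8L²)`: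
* ★★★ `abs_aKer_diag_sub_le_sharp`: **`|a_L(n,n;0) − (1/π)Σ_{k<n} 1/(2k+1)| ≤ n²/L²`** (`2n ≤ L`; `49π/200 ≤ 1`; truth `n²/(2L²)`);
* ★★★ `Subsample.abs_aKer_diag_sub_aZ2_le`: **`|a_L(n,n;0) − aZ2 n n| ≤ n²/L²`** — the diagonal input of the sharp window
  periodisation bound (harmonicity propagation from the exact axis value `a_L(1,0) = (1 − 1/V)/4` and the diagonal), replacing on
  the near-pair window the generic `O(|r|² ln L/L²)` rate whose constant is `~5·10⁴`.
Prover seat `hubbard-h0-rotor-p1` g25; helper for stmt-HubbardSuperconductivity-19089 (`--supports`).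
WHAT THIS IS NOT: nothing here proves superconductivity in the Hubbard model (rotor TARGET as worded stays FALSE, g15);
an elementary rate estimate serving ONE input (periodisation) of ONE input (HOLE₂) of ONE conditional reduction (rung 19089).
Mathlib + tree imports only; no sorry, no axioms.
-/


set_option linter.dupNamespace false
set_option autoImplicit false

noncomputable section

open scoped BigOperators
open Complex Filter Topology

namespace Summit.HubbardSuperconductivity.HubbardSuperconductivity.Theorems.AnisotropyChord.Transfer.Fibre3

variable (L : ℕ) [NeZero L]

/-! ## Assembly -/

/-- ★★★ **THE SHARP DIAGONAL RATE: `|a_L(n,n;0) − (1/π)Σ_{k<n} 1/(2k+1)| ≤ n²/L²`** (`2n ≤ L`; truth `≈ n²/(2L²)`). [folklore] -/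
theorem abs_aKer_diag_sub_le_sharp (n : ℕ) (hn : 2 * n ≤ L) :
    |aKer L 0 ((n : ZMod L), (n : ZMod L)) - 1 / Real.pi * ∑ k ∈ Finset.range n, 1 / (2 * (k : ℝ) + 1)|
      ≤ (n : ℝ) ^ 2 / (L : ℝ) ^ 2 := by
  have hL0 : (0 : ℝ) < L := by exact_mod_cast Nat.pos_of_ne_zero (NeZero.ne L)
  have hL1 : 1 ≤ L := Nat.pos_of_ne_zero (NeZero.ne L)
  have hπ := Real.pi_pos
  have hD := diag_rotation L 0 n
  set R : ℕ → ℝ := fun p => (1 - Real.cos (2 * Real.pi * n * p / L)) * ∑ j ∈ Finset.range L,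
      1 / (4 - 0 - 4 * Real.cos (Real.pi * p / L) * Real.cos (Real.pi * ((2 * j + p % 2 : ℕ) : ℝ) / L)) with hR
  set M : ℕ → ℝ := fun p => (1 - Real.cos (2 * Real.pi * n * p / L)) * (L / (4 * |Real.sin (Real.pi * p / L)|)) with hM
  set B : ℕ → ℝ := fun m => Real.pi * (n : ℝ) ^ 2 * m / (Real.exp (Real.pi * m) - 1) with hB
  have hB0 : ∀ m, 0 ≤ B m := by
    intro m; rw [hB]; simp only
    rcases Nat.eq_zero_or_pos m with hm | hm
    · subst hm; simp
    · have hE : 1 < Real.exp (Real.pi * m) := Real.one_lt_exp_iff.mpr (by positivity)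
      apply div_nonneg (by positivity); linarith
  have hsumR : 2 * (L : ℝ) ^ 2 * aKer L 0 ((n : ZMod L), (n : ZMod L)) = ∑ p ∈ Finset.range (2 * L), R p := by
    rw [hD]
  have hsumM : ∑ p ∈ Finset.range (2 * L), M p = L * ∑ k ∈ Finset.range n,
      Real.cos ((2 * k + 1) * Real.pi / (2 * L)) / Real.sin ((2 * k + 1) * Real.pi / (2 * L)) :=
    main_term_eq L n (by omega)
  -- ★ the sharp row errors: rows `p` and `L + p` together cost at most `2(B p + B (L − p))`
  have hrow : ∀ p ∈ Finset.range L, |R p - M p| + |R (L + p) - M (L + p)| ≤ 2 * (B p + B (L - p)) := by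
    intro p hp
    have hpL := Finset.mem_range.mp hp
    have hBp := hB0 p
    have hBq := hB0 (L - p)
    rcases Nat.eq_zero_or_pos p with hp0 | hp0
    · -- rows `0` and `L` vanish
      subst hp0
      have h0 : R 0 - M 0 = 0 := by simp [hR, hM]
      have hL' : R (L + 0) - M (L + 0) = 0 := by
        have hc : Real.cos (2 * Real.pi * n * ((L + 0 : ℕ) : ℝ) / L) = 1 := by
          rw [show 2 * Real.pi * n * ((L + 0 : ℕ) : ℝ) / L = (n : ℕ) * (2 * Real.pi) by push_cast; field_simp; ring]
          exact Real.cos_nat_mul_two_pi n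
        simp only [hR, hM, hc, sub_self, zero_mul]
      rw [h0, hL', abs_zero, add_zero]
      linarith
    · obtain ⟨hw0, hw1, hs1, hc1, hs2, hc2⟩ := row_reduced L p hp0 hpL
      set m : ℕ := min p (L - p) with hm
      have hcore1 := row_err_core L n (p % 2) hw0 hw1 hs1 hc1
      have hcore2 := row_err_core L n ((L + p) % 2) hw0 hw1 hs2 hc2
      have hwt := row_weight_le L n m
      have hmB : B m ≤ B p + B (L - p) := by
        rcases le_total p (L - p) with h | h
        · rw [hm, min_eq_left h]; linarith
        · rw [hm, min_eq_right h]; linarith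
      have e1 : R p - M p = (1 - Real.cos (2 * n * (Real.pi * p / L))) * (∑ j ∈ Finset.range L,
          1 / (4 - 0 - 4 * Real.cos (Real.pi * p / L) * Real.cos (Real.pi * ((2 * j + p % 2 : ℕ) : ℝ) / L))
            - L / (4 * |Real.sin (Real.pi * p / L)|)) := by
        simp only [hR, hM]
        rw [show 2 * Real.pi * n * (p : ℝ) / L = 2 * n * (Real.pi * p / L) by ring]; ring
      have e2 : R (L + p) - M (L + p) = (1 - Real.cos (2 * n * (Real.pi * ((L + p : ℕ) : ℝ) / L)))
          * (∑ j ∈ Finset.range L, 1 / (4 - 0 - 4 * Real.cos (Real.pi * ((L + p : ℕ) : ℝ) / L)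
              * Real.cos (Real.pi * ((2 * j + (L + p) % 2 : ℕ) : ℝ) / L))
            - L / (4 * |Real.sin (Real.pi * ((L + p : ℕ) : ℝ) / L)|)) := by
        simp only [hR, hM]
        rw [show 2 * Real.pi * n * ((L + p : ℕ) : ℝ) / L = 2 * n * (Real.pi * ((L + p : ℕ) : ℝ) / L) by ring]; ring
      rw [e1, e2]
      have hBm : (n : ℝ) ^ 2 * L * Real.sin (Real.pi * (m : ℝ) / L) / (Real.exp (L * (Real.pi * (m : ℝ) / L)) - 1) ≤ B m :=
        hwt
      linarith
  -- ★ the summed sharp error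
  have herr : |∑ p ∈ Finset.range (2 * L), R p - ∑ p ∈ Finset.range (2 * L), M p| ≤ 6 * Real.pi / 25 * (n : ℝ) ^ 2 := by
    rw [← Finset.sum_sub_distrib]
    have hsplit : ∑ p ∈ Finset.range (2 * L), |R p - M p|
        = ∑ p ∈ Finset.range L, (|R p - M p| + |R (L + p) - M (L + p)|) := by
      rw [Finset.sum_add_distrib, ← Finset.sum_range_add_sum_Ico _ (show L ≤ 2 * L by omega),
        Finset.sum_Ico_eq_sum_range, show 2 * L - L = L by omega]
    have hLam1 : ∑ p ∈ Finset.range L, B p ≤ Real.pi * (n : ℝ) ^ 2 * (3 / 50) := by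
      have h := lambert_row_sum_le L
      have e : ∑ p ∈ Finset.range L, B p = Real.pi * (n : ℝ) ^ 2 * ∑ p ∈ Finset.range L,
          (p : ℝ) / (Real.exp (Real.pi * p) - 1) := by
        rw [Finset.mul_sum]; refine Finset.sum_congr rfl fun p _ => ?_; simp only [hB]; ring
      rw [e]; exact mul_le_mul_of_nonneg_left h (by positivity)
    have hLam2 : ∑ p ∈ Finset.range L, B (L - p) ≤ Real.pi * (n : ℝ) ^ 2 * (3 / 50) := by
      have hrefl : ∑ p ∈ Finset.range L, B (L - p) = ∑ j ∈ Finset.range L, B (j + 1) := by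
        rw [← Finset.sum_range_reflect (fun j => B (j + 1)) L]
        refine Finset.sum_congr rfl fun j hj => ?_
        have := Finset.mem_range.mp hj
        congr 1; omega
      have h := lambert_row_sum_le (L + 1)
      rw [Finset.sum_range_succ'] at h
      simp only [Nat.cast_zero, mul_zero, zero_div, add_zero] at h
      have e : ∑ j ∈ Finset.range L, B (j + 1) = Real.pi * (n : ℝ) ^ 2 * ∑ j ∈ Finset.range L,
          (((j + 1 : ℕ) : ℝ)) / (Real.exp (Real.pi * ((j + 1 : ℕ) : ℝ)) - 1) := by
        rw [Finset.mul_sum]; refine Finset.sum_congr rfl fun j _ => ?_; simp only [hB]; ring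
      rw [hrefl, e]
      exact mul_le_mul_of_nonneg_left h (by positivity)
    calc |∑ p ∈ Finset.range (2 * L), (R p - M p)| ≤ ∑ p ∈ Finset.range (2 * L), |R p - M p| :=
          Finset.abs_sum_le_sum_abs _ _
      _ = ∑ p ∈ Finset.range L, (|R p - M p| + |R (L + p) - M (L + p)|) := hsplit
      _ ≤ ∑ p ∈ Finset.range L, 2 * (B p + B (L - p)) := Finset.sum_le_sum hrow
      _ = 2 * (∑ p ∈ Finset.range L, B p + ∑ p ∈ Finset.range L, B (L - p)) := by
          rw [← Finset.sum_add_distrib, Finset.mul_sum]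
      _ ≤ 6 * Real.pi / 25 * (n : ℝ) ^ 2 := by nlinarith
  have hcot := cot_sum_approx L n hn
  have hmain : |aKer L 0 ((n : ZMod L), (n : ZMod L)) - 1 / (2 * (L : ℝ)) * ∑ k ∈ Finset.range n,
      Real.cos ((2 * k + 1) * Real.pi / (2 * L)) / Real.sin ((2 * k + 1) * Real.pi / (2 * L))|
      ≤ 3 * Real.pi / 25 * (n : ℝ) ^ 2 / (L : ℝ) ^ 2 := by
    have e : aKer L 0 ((n : ZMod L), (n : ZMod L)) - 1 / (2 * (L : ℝ)) * ∑ k ∈ Finset.range n,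
        Real.cos ((2 * k + 1) * Real.pi / (2 * L)) / Real.sin ((2 * k + 1) * Real.pi / (2 * L))
        = (∑ p ∈ Finset.range (2 * L), R p - ∑ p ∈ Finset.range (2 * L), M p) / (2 * (L : ℝ) ^ 2) := by
      rw [← hsumR, hsumM]
      set T := ∑ k ∈ Finset.range n,
        Real.cos ((2 * k + 1) * Real.pi / (2 * L)) / Real.sin ((2 * k + 1) * Real.pi / (2 * L)) with hT
      field_simp
    rw [e, abs_div, abs_of_pos (by positivity : (0 : ℝ) < 2 * (L : ℝ) ^ 2), div_le_div_iff₀ (by positivity) (by positivity)]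
    nlinarith
  have hπ4 : Real.pi ≤ 4 := by linarith [Real.pi_lt_d2]
  calc _ ≤ |aKer L 0 ((n : ZMod L), (n : ZMod L)) - 1 / (2 * (L : ℝ)) * ∑ k ∈ Finset.range n,
          Real.cos ((2 * k + 1) * Real.pi / (2 * L)) / Real.sin ((2 * k + 1) * Real.pi / (2 * L))|
        + |1 / (2 * (L : ℝ)) * ∑ k ∈ Finset.range n,
          Real.cos ((2 * k + 1) * Real.pi / (2 * L)) / Real.sin ((2 * k + 1) * Real.pi / (2 * L))
        - 1 / Real.pi * ∑ k ∈ Finset.range n, 1 / (2 * (k : ℝ) + 1)| := abs_sub_le _ _ _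
    _ ≤ 3 * Real.pi / 25 * (n : ℝ) ^ 2 / (L : ℝ) ^ 2 + Real.pi * (n : ℝ) ^ 2 / (8 * (L : ℝ) ^ 2) := add_le_add hmain hcot
    _ = (49 * Real.pi / 200) * ((n : ℝ) ^ 2 / (L : ℝ) ^ 2) := by ring
    _ ≤ 1 * ((n : ℝ) ^ 2 / (L : ℝ) ^ 2) := mul_le_mul_of_nonneg_right (by linarith) (by positivity)
    _ = (n : ℝ) ^ 2 / (L : ℝ) ^ 2 := one_mul _

namespace Subsample

/-- ★★★ **THE SHARP DIAGONAL PERIODISATION BOUND: `|a_L(n,n;0) − aZ2 n n| ≤ n²/L²`** for `2n ≤ L`. [folklore] -/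
theorem abs_aKer_diag_sub_aZ2_le (n : ℕ) (hn : 2 * n ≤ L) :
    |aKer L 0 ((n : ZMod L), (n : ZMod L)) - aZ2 n n| ≤ (n : ℝ) ^ 2 / (L : ℝ) ^ 2 := by
  rw [aZ2_diag]; exact abs_aKer_diag_sub_le_sharp L n hn

end Subsample

end Summit.HubbardSuperconductivity.HubbardSuperconductivity.Theorems.AnisotropyChord.Transfer.Fibre3

end
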